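import Mathlib
import HarnessLib
import Literature.Computability.QuantumComplexity.QuantumAdvantageWave0

/-!
# Permanent anti-concentration: PACC from a polynomial small-ball bound

Companion to `QuantumAdvantageWave0.lean`, which states the Permanent Anti-Concentration Conjecture
`PermanentAntiConcentrationConjecture` (PACC; Aaronson–Arkhipov, *The computational complexity of
linear optics*, Theory of Computing 9 (2013) 143–252, §1.2.3, Conjecture 1.6). In §8 (p. 218,
eq. (8.2)) Aaronson–Arkhipov remark that PACC is equivalent to a polynomial small-ball bound: there
are constants `C, D` and `β > 0` with `Pr_{X ∼ 𝒩(0,1)_ℂ^{n×n}}[|Per X| < ε √(n!)] < C n^D ε^β` for all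
`n` and all `ε > 0`. This file PROVES the direction of that equivalence through which any discharge
of PACC has to pass:

* `PermanentAntiConcentrationConjecture.of_smallBall`: a bound of the form (8.2), assumed only for
  `n ≥ 1` and with non-strict inequality, implies PACC, with the explicit polynomial
  `p(n, 1/δ) = max(C,1)^{1/β} (n+1)^k (1+1/δ)^k`, `k = ⌈(D+1)/β⌉`.
* `PermanentAntiConcentrationConjecture.of_smallBall_sq`: the case `D = 1`, `β = 2`, i.e. a bound
  `Pr[|Per X| < ε √(n!)] ≤ C · n · ε²` for `n ≥ 1`, `ε > 0`. This is exactly the shape (at centre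
  `z = 0`) of the estimate `sup_z Pr[|Per G_n - z| ≤ ε √(n!)] ≲ n ε²` announced for the complex
  Ginibre ensemble in the preprint Koehler–Leung, *Anticoncentration of the permanent in Ginibre
  ensembles*, arXiv:2607.20329 (July 2026), Theorem 1.1 (case `K = ℂ`), which claims a proof of
  PACC; that preprint is unrefereed at the time of writing and is NOT vendored here.

Why only `n ≥ 1` in the hypotheses: the `n = 0` instance of PACC is settled outright
(`gaussianMatrixMeasure_real_permanent_lt_eq_zero`: the empty permanent is `1`, at least the
threshold), and the announced small-ball bound is stated for `n ≥ 1` (for `n = 0` a bound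
`C · 0 · ε²` would be false).

Status of PACC itself: it stays a named `Prop` without `_holds`. Posed in 2011/2013, it was open
until the 2026 announcement above, whose 110-page argument (comparison of permanental and
determinantal Gaussian cofactor matrices in Laplace-transform order) is far beyond this file.

Not here: the converse direction PACC ⇒ (8.2) (not needed for a discharge); any part of the
Koehler–Leung argument; the moment computations of Aaronson–Arkhipov §8 (see
`GaussianPermanentMoments.lean`).
-/

namespace Literature.Computability.QuantumComplexity

open _root_.MeasureTheory

section PACCReductions

/-- Degenerate size `n = 0`: the permanent of the empty matrix is `1`, so the PACC bad event
`{X | ‖Per X‖ < t}` over `0 × 0` matrices is empty, hence null, as soon as `t ≤ 1`. [folklore] -/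
theorem gaussianMatrixMeasure_real_permanent_lt_eq_zero {t : ℝ} (ht : t ≤ 1) :
    (gaussianMatrixMeasure 0).real {X | ‖(Matrix.of X).permanent‖ < t} = 0 := by
  have h : {X : Fin 0 → Fin 0 → ℂ | ‖(Matrix.of X).permanent‖ < t} = ∅ := by
    ext X
    simp only [Set.mem_setOf_eq, Set.mem_empty_iff_false, iff_false, not_lt]
    rw [Matrix.permanent_isEmpty, norm_one]
    exact ht
  rw [h, measureReal_empty]

/-- Arithmetic core of `PermanentAntiConcentrationConjecture.of_smallBall`: with
`x = (n+1)(1+δ⁻¹)` and any exponent `t ≥ D + 1`, the small-ball bound evaluated at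
`ε = (max(C,1)^{1/β} x^k)⁻¹` is below `δ`:  `C n^D / (C₁ x^t) < δ` whenever `C ≤ C₁`, `0 < C₁`.
[folklore] -/
theorem smallBall_scale_lt {C C₁ t δ : ℝ} {n D : ℕ} (hCC₁ : C ≤ C₁) (hC₁ : 0 < C₁)
    (hδ : 0 < δ) (ht : (D : ℝ) + 1 ≤ t) :
    C * (n : ℝ) ^ D * (C₁ * (((n : ℝ) + 1) * (1 + δ⁻¹)) ^ t)⁻¹ < δ := by
  set x : ℝ := ((n : ℝ) + 1) * (1 + δ⁻¹) with hx
  have hn1 : (1 : ℝ) ≤ (n : ℝ) + 1 := by simp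
  have hδ1 : (1 : ℝ) ≤ 1 + δ⁻¹ := le_add_of_nonneg_right (inv_nonneg.mpr hδ.le)
  have hx1 : 1 ≤ x := one_le_mul_of_one_le_of_one_le hn1 hδ1
  have hx0 : 0 < x := one_pos.trans_le hx1
  have hxt : 0 < x ^ t := Real.rpow_pos_of_pos hx0 t
  have hnD : 0 ≤ (n : ℝ) ^ D := by positivity
  -- step 1: replace `C` by `C₁ ≥ C` and cancel it
  have step1 : C * (n : ℝ) ^ D * (C₁ * x ^ t)⁻¹ ≤ (n : ℝ) ^ D * (x ^ t)⁻¹ := by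
    calc C * (n : ℝ) ^ D * (C₁ * x ^ t)⁻¹
        ≤ C₁ * (n : ℝ) ^ D * (C₁ * x ^ t)⁻¹ :=
          mul_le_mul_of_nonneg_right (mul_le_mul_of_nonneg_right hCC₁ hnD)
            (inv_nonneg.mpr (mul_nonneg hC₁.le hxt.le))
      _ = (n : ℝ) ^ D * (x ^ t)⁻¹ := by
          field_simp
  -- step 2: `n^D / x^t < δ`
  have step2 : (n : ℝ) ^ D * (x ^ t)⁻¹ < δ := by
    rw [← div_eq_mul_inv, div_lt_iff₀ hxt]
    have hxt_ge : x ^ ((D : ℝ) + 1) ≤ x ^ t := Real.rpow_le_rpow_of_exponent_le hx1 ht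
    have hxD1 : x ^ ((D : ℝ) + 1) = x ^ D * x := by
      rw [← Nat.cast_succ, Real.rpow_natCast, pow_succ]
    have hxD : ((n : ℝ) + 1) ^ D ≤ x ^ D :=
      pow_le_pow_left₀ (by positivity) (le_mul_of_one_le_right (by positivity) hδ1) D
    have hx_ge : 1 + δ⁻¹ ≤ x := le_mul_of_one_le_left (by positivity) hn1
    have hnD' : (n : ℝ) ^ D ≤ ((n : ℝ) + 1) ^ D := pow_le_pow_left₀ (by positivity) (by simp) D
    have hδ0 : δ ≠ 0 := hδ.ne'
    calc (n : ℝ) ^ D ≤ ((n : ℝ) + 1) ^ D := hnD'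
      _ < ((n : ℝ) + 1) ^ D * (δ + 1) := lt_mul_of_one_lt_right (by positivity) (by linarith)
      _ = δ * (((n : ℝ) + 1) ^ D * (1 + δ⁻¹)) := by
          field_simp
      _ ≤ δ * (x ^ D * x) := by gcongr
      _ = δ * x ^ ((D : ℝ) + 1) := by rw [hxD1]
      _ ≤ δ * x ^ t := mul_le_mul_of_nonneg_left hxt_ge hδ.le
  exact step1.trans_lt step2

/-- **PACC from a polynomial small-ball bound** — the direction (8.2) ⇒ (8.1) of the equivalence
asserted by Aaronson–Arkhipov (2013, §8, p. 218: "An equivalent formulation is that there exist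
constants `C, D` and `β > 0` such that for all `n` and `ε > 0`,
`Pr_{X ∼ 𝒢^{n×n}}[|Per X| < ε √(n!)] < C n^D ε^β`"). Precisely: if such a bound holds (non-strictly)
for all `n ≥ 1` and `ε > 0`, then `PermanentAntiConcentrationConjecture` holds, with
`p(n, 1/δ) = max(C,1)^{1/β} (n+1)^k (1+1/δ)^k`, `k = ⌈(D+1)/β⌉`. (The case `n = 0` needs no
hypothesis.) [cite: AaronsonArkhipovToC2013, §8 eq. (8.2) p. 218] -/
theorem PermanentAntiConcentrationConjecture.of_smallBall
    (h : ∃ (C : ℝ) (D : ℕ) (β : ℝ), 0 < β ∧ ∀ n : ℕ, 1 ≤ n → ∀ ε : ℝ, 0 < ε →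
      (gaussianMatrixMeasure n).real
          {X | ‖(Matrix.of X).permanent‖ < ε * Real.sqrt (n.factorial : ℝ)} ≤
        C * (n : ℝ) ^ D * ε ^ β) :
    PermanentAntiConcentrationConjecture := by
  obtain ⟨C, D, β, hβ, h⟩ := h
  -- the constants of the polynomial `p(n, 1/δ) = C₀ (n+1)^k (1+δ⁻¹)^k`
  set C₁ : ℝ := max C 1 with hC₁
  have hC₁_one : 1 ≤ C₁ := le_max_right _ _
  have hC₁_pos : 0 < C₁ := one_pos.trans_le hC₁_one
  have hCC₁ : C ≤ C₁ := le_max_left _ _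
  set C₀ : ℝ := C₁ ^ β⁻¹ with hC₀
  have hC₀_one : 1 ≤ C₀ := Real.one_le_rpow hC₁_one (inv_nonneg.mpr hβ.le)
  have hC₀_pos : 0 < C₀ := one_pos.trans_le hC₀_one
  set k : ℕ := ⌈((D : ℝ) + 1) / β⌉₊ with hk
  have hkβ : (D : ℝ) + 1 ≤ (k : ℝ) * β := by
    have : ((D : ℝ) + 1) / β ≤ k := Nat.le_ceil _
    rwa [div_le_iff₀ hβ] at this
  refine ⟨C₀, k, hC₀_pos, fun n δ hδ => ?_⟩
  have hδinv : 0 < 1 + δ⁻¹ := by positivity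
  have hone_le : 1 ≤ 1 + δ⁻¹ := le_add_of_nonneg_right (inv_nonneg.mpr hδ.le)
  rcases Nat.eq_zero_or_pos n with rfl | hn
  · -- `n = 0`: the bad event is empty
    rw [gaussianMatrixMeasure_real_permanent_lt_eq_zero]
    · exact hδ
    · rw [Nat.factorial_zero, Nat.cast_one, Real.sqrt_one, Nat.cast_zero, zero_add, one_pow, mul_one,
        div_le_one (mul_pos hC₀_pos (pow_pos hδinv k))]
      exact one_le_mul_of_one_le_of_one_le hC₀_one (one_le_pow₀ hone_le)
  · -- `n ≥ 1`: apply the small-ball bound at `ε = A⁻¹`, `A = p(n, 1/δ)`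
    set A : ℝ := C₀ * ((n : ℝ) + 1) ^ k * (1 + δ⁻¹) ^ k with hA
    have hx0 : 0 ≤ ((n : ℝ) + 1) * (1 + δ⁻¹) := by positivity
    have hAx : A = C₀ * (((n : ℝ) + 1) * (1 + δ⁻¹)) ^ k := by rw [hA, mul_pow, mul_assoc]
    have hA_pos : 0 < A := by rw [hAx]; positivity
    have hε : 0 < A⁻¹ := inv_pos.mpr hA_pos
    have hset : {X : Fin n → Fin n → ℂ | ‖(Matrix.of X).permanent‖ <
          Real.sqrt (n.factorial : ℝ) / A} =
        {X | ‖(Matrix.of X).permanent‖ < A⁻¹ * Real.sqrt (n.factorial : ℝ)} := by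
      ext X
      simp only [Set.mem_setOf_eq, div_eq_inv_mul]
    rw [hset]
    refine (h n hn A⁻¹ hε).trans_lt ?_
    have hAβ : (A⁻¹) ^ β = (C₁ * (((n : ℝ) + 1) * (1 + δ⁻¹)) ^ ((k : ℝ) * β))⁻¹ := by
      rw [Real.inv_rpow hA_pos.le, hAx, Real.mul_rpow hC₀_pos.le (pow_nonneg hx0 k), hC₀,
        Real.rpow_inv_rpow hC₁_pos.le hβ.ne', Real.rpow_natCast_mul hx0]
    rw [hAβ]
    exact smallBall_scale_lt hCC₁ hC₁_pos hδ hkβ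

/-- **PACC from a quadratic small-ball bound.** If for some constant `C`, all `n ≥ 1` and all
`ε > 0`, `Pr_{X ∼ 𝒩(0,1)_ℂ^{n×n}}[|Per X| < ε √(n!)] ≤ C · n · ε²`, then
`PermanentAntiConcentrationConjecture` holds. This is the shape (at centre `0`) of the bound
`sup_z Pr[|Per G_n - z| ≤ ε √(n!)] ≲ n ε²` announced for the complex Ginibre ensemble by
Koehler–Leung (arXiv:2607.20329, 2026, Theorem 1.1, `K = ℂ`; unrefereed preprint, not vendored
here): a discharge of PACC from that result is this one-line reduction. [folklore] -/
theorem PermanentAntiConcentrationConjecture.of_smallBall_sq {C : ℝ}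
    (h : ∀ n : ℕ, 1 ≤ n → ∀ ε : ℝ, 0 < ε →
      (gaussianMatrixMeasure n).real
          {X | ‖(Matrix.of X).permanent‖ < ε * Real.sqrt (n.factorial : ℝ)} ≤ C * n * ε ^ 2) :
    PermanentAntiConcentrationConjecture :=
  PermanentAntiConcentrationConjecture.of_smallBall
    ⟨C, 1, 2, two_pos, fun n hn ε hε => by simpa only [pow_one, Real.rpow_two] using h n hn ε hε⟩

end PACCReductions

end Literature.Computability.QuantumComplexity
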